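import Literature.AlgebraicGeometry.RelativeSpec.EquivariantModuleDescentUnique
import Literature.AlgebraicGeometry.Modules.EquivariantStructureRestrictOfPullback
import Literature.AlgebraicGeometry.KTheory.PullbackVectorBundle
import HarnessLib

/-!
# Descent of the trivial line bundle along a free finite quotient: when is a descended module trivial?

Layer `Literature/AlgebraicGeometry/RelativeSpec`, namespace `Literature.AlgebraicGeometry.RelativeSpec.ActionOver`.
THEOREMS ONLY (no definition, no named fact, no instance).  Sequel to ★ (T1) `RelativeSpec/EquivariantModuleDescent`,
★ (T2) `RelativeSpec/EquivariantModuleDescentUnique` and ★ `Modules/EquivariantStructure(RestrictOfPullback)`.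

Setting: `ρ : ActionOver p G`, `p : X ⟶ Q` an affine, flat geometric quotient by the FREE action of the finite group `G`;
`M` a quasi-coherent module on `Q` whose pull-back `p^* M` is TRIVIAL, `e : p^* 𝒪_Q ≅ p^* M`.  The pulled-back
generator `s := e(η_p(1))` is a global section of `p^* M`, and `p^* M` carries the canonical `G`-linearisation
★ `EquivariantStructure.ofPullback ρ M`, so `G` acts on its sections (★ `actSections`).  [MumfordAV1970] §12 Thm. 1
(«`L ↦ π^* L` is an equivalence between sheaves on `X/G` and `G`-sheaves on `X`»; the kernel of `Pic(X/G) → Pic X`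
is `H¹(G, Γ(X, 𝒪_X)ˣ)`): the class of `M` is measured by how far `s` is from being invariant.

* §1 section formulas: `actSections_unitSection_ofPullback` — pulled-back sections `η_p(m)` are INVARIANT for the
  canonical linearisation; `actSections_map` — the action commutes with restriction; `appLE_aut_app` — functions from
  the base are fixed.
* §2 **`nonempty_iso_unit_of_actSections_eq`** — if the generator `s` is `G`-invariant then `M ≅ 𝒪_Q`: the adjunct
  `𝒪_Q ⟶ p_* p^* M` of `e` lands in the invariants `(p_* p^* M)^G` (★ T2's mechanism, here from a SECTION-LEVEL
  hypothesis), and both `𝒪_Q` and `M` compare isomorphically with `(p_* p^* M)^G` because `p^*` of the comparison is an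
  isomorphism (★ T1 `isIso_descentHom`) and `p^*` reflects isomorphisms (★ `isIso_of_isIso_pullback_map`, `p` flat
  surjective).
* §3 `actSections_eq_self_of_iso_unit` — conversely, if `M ≅ 𝒪_Q` and `G` fixes the global functions of `X`, EVERY
  global section of `p^* M` is invariant.
* §4 `actSections_squareIso_unitSection` — the action on a restricted global section along an equivariant square
  `ι ≫ p = p′ ≫ κ` (★ `restrictAlong_ofPullback`): if `g · s = a s` then `g · s′ = ι^♯(a) s′` for the restricted
  generator `s′` of `p′^* κ^* M`.

Cell `hodgecm-mathlib` (D-0151), HECKE-LINK D6 stub (K4) «the `K`-descent character of `π^*𝒫_c` is locally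
constant» (B-plan1 (g14) 21:39:01Z (P2); consumer `AbelianSchemes/AbelianSchemeQuotientDescentOfUnitRigid`).
Count-neutral; HC_CM is proved only modulo the 7 printed citations until rung 0 closes — nothing here is about HC.

## References
* [MumfordAV1970] D. Mumford, *Abelian Varieties* (1970), §7 Prop. 2 (p. 70), §12 Thm. 1 (p. 112).
* [Greither1992CyclicGalois] C. Greither, LNM 1534 (1992), Ch. 0 Thm. 7.1, Prop. 7.2 (pp. 28–29).
* [MumfordFogartyKirwan1994] D. Mumford, J. Fogarty, F. Kirwan, *GIT*, 3rd ed., Ch. 1 §3 Def. 1.6 (p. 30), Prop. 7.1.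
-/

set_option autoImplicit false

noncomputable section

-- `TopCat.Presheaf`/`Scheme.Modules` are not reducible (as in Mathlib's `AlgebraicGeometry/Modules`).
set_option backward.isDefEq.respectTransparency false

universe u

open CategoryTheory Limits AlgebraicGeometry TopologicalSpace Opposite
open Literature.AlgebraicGeometry.Modules Literature.AlgebraicGeometry.HodgeTheory Literature.AlgebraicGeometry.Motives

namespace Literature.AlgebraicGeometry.RelativeSpec.ActionOver

section Main

variable {X Q : Scheme.{u}} {p : X ⟶ Q} {G : Type u} [Group G] (ρ : ActionOver p G)

/-! ## §1 Section formulas -/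

/-- **Pulled-back sections are invariant for the canonical linearisation**: `g · η_p(m) = η_p(m)` for the action on
sections of `p^* F` induced by ★ `EquivariantStructure.ofPullback ρ F` (★ `ofPullback_iso_hom_app_unitSection` up to
the transport `σ_g⁻¹ p⁻¹ V = p⁻¹ V`). [cite: MumfordAV1970, §7 Prop. 2 (p. 70)] -/
theorem actSections_unitSection_ofPullback (F : Q.Modules) (g : G) (V : Q.Opens) (m : Γ(F, V)) :
    ρ.actSections ((Scheme.Modules.pullback p).obj F) (EquivariantStructure.ofPullback ρ F).iso g V
        (unitSection p F V m) = unitSection p F V m := by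
  rw [actSections_eq]
  erw [ofPullback_iso_hom_app_unitSection ρ F g V m]
  exact (presheaf_map_map_congr _ _ _ (𝟙 _) _).trans (presheaf_map_self _ _ _)

/-- **The action on sections commutes with restriction** along `W ≤ V` (naturality of ★ `pushforwardAct`).
[cite: MumfordFogartyKirwan1994, Ch. 1 §3 Definition 1.6 (p. 30)] -/
theorem actSections_map (E : X.Modules) (φ : ∀ g : G, (Scheme.Modules.pullback (ρ.aut g).hom).obj E ≅ E) (g : G)
    {V W : Q.Opens} (i : W ⟶ V) (s : Γ(E, p ⁻¹ᵁ V)) :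
    ρ.actSections E φ g W (E.presheaf.map ((Opens.map p.base).map i).op s) =
      E.presheaf.map ((Opens.map p.base).map i).op (ρ.actSections E φ g V s) := by
  change (ρ.pushforwardAct E φ g).app W (((Scheme.Modules.pushforward p).obj E).presheaf.map i.op s) =
    ((Scheme.Modules.pushforward p).obj E).presheaf.map i.op ((ρ.pushforwardAct E φ g).app V s)
  exact app_presheaf_map _ _ _

/-- **Functions from the base are fixed by the action**: `σ_g^♯ (p^♯ a) = p^♯ a` on `p⁻¹V` (the `appLE` form in which
★ `actSections_smul` produces its scalar). [cite: MumfordAV1970, §7 Prop. 2 (p. 70)] -/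
theorem appLE_aut_app (g : G) (V : Q.Opens) (a : Γ(Q, V)) :
    (ρ.aut g).hom.appLE (p ⁻¹ᵁ V) (p ⁻¹ᵁ V) (ρ.preimage_preimage g V).ge (p.app V a) = p.app V a := by
  have h := ρ.act_app g⁻¹ V a
  rw [act_apply] at h
  simpa only [inv_inv] using h

/-- The pulled-back unit generates: a section `y ∈ Γ(𝒪_Q, V)` pulls back to `p^♯ y · η_p(1)|_{p⁻¹V}`.
[cite: MumfordAV1970, §7 Prop. 2 (p. 70)] -/
theorem unitSection_unit_eq (V : Q.Opens) (y : Γ(SheafOfModules.unit Q.ringCatSheaf, V)) :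
    unitSection p (SheafOfModules.unit _) V y =
      p.app V y • ((Scheme.Modules.pullback p).obj (SheafOfModules.unit _)).presheaf.map
        ((Opens.map p.base).map (homOfLE le_top)).op (unitSection p (SheafOfModules.unit _) ⊤ (1 : Γ(Q, ⊤))) := by
  rw [← unitSection_map, ← unitSection_smul]
  congr 1
  have h1 : (Scheme.Modules.presheaf (SheafOfModules.unit Q.ringCatSheaf)).map (homOfLE (le_top (a := V))).op
      (1 : Γ(Q, ⊤)) =
      (1 : Γ(Q, V)) :=
    map_one (Q.presheaf.map (homOfLE (le_top (a := V))).op).hom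
  rw [h1]
  change y = @HMul.hMul Γ(Q, V) Γ(Q, V) Γ(Q, V) instHMul y (1 : Γ(Q, V))
  exact (@mul_one Γ(Q, V) _ y).symm

/-! ## §2 Triviality of the descended module from invariance of the pulled-back generator -/

section Trivial

variable [Fintype G]

omit [Fintype G] in
/-- **A morphism `e′ : p^* F′ ⟶ E` which is invariant on pulled-back sections has a `G`-invariant adjunct**
`F′ ⟶ p_* E` (★ `homEquiv_comp_pushforwardAct_eq` with its compatibility hypothesis replaced by the SECTION-LEVEL
statement `g · e′(η_p x) = e′(η_p x)` it reduces to). [cite: Greither1992CyclicGalois, Ch. 0 Prop. 7.2 (p. 29)] -/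
theorem homEquiv_comp_pushforwardAct_eq_of_actSections (E : X.Modules)
    (φ : ∀ g : G, (Scheme.Modules.pullback (ρ.aut g).hom).obj E ≅ E) (F' : Q.Modules)
    (e' : (Scheme.Modules.pullback p).obj F' ⟶ E)
    (h : ∀ (g : G) (V : Q.Opens) (x : Γ(F', V)),
      ρ.actSections E φ g V (e'.app (p ⁻¹ᵁ V) (unitSection p F' V x)) = e'.app (p ⁻¹ᵁ V) (unitSection p F' V x))
    (g : G) :
    (Scheme.Modules.pullbackPushforwardAdjunction p).homEquiv F' E e' ≫ ρ.pushforwardAct E φ g =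
      (Scheme.Modules.pullbackPushforwardAdjunction p).homEquiv F' E e' := by
  refine Scheme.Modules.hom_ext _ _ fun V => ?_
  ext x
  rw [Scheme.Modules.Hom.comp_app, CategoryTheory.comp_apply, pullbackObj_homEquiv_app]
  exact h g V x

/-- **Factorisation through the invariants, section form**: an `e′ : p^* F′ ⟶ E` invariant on pulled-back sections
factors as `p^* j ≫ (p^*(p_* E)^G ⟶ E)` for some `j : F′ ⟶ (p_* E)^G` (★ `exists_hom_moduleInvariants_fac`, same
proof). [cite: Greither1992CyclicGalois, Ch. 0 Prop. 7.2 (p. 29)] -/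
theorem exists_hom_moduleInvariants_fac_of_actSections (E : X.Modules)
    (φ : ∀ g : G, (Scheme.Modules.pullback (ρ.aut g).hom).obj E ≅ E) (F' : Q.Modules)
    (e' : (Scheme.Modules.pullback p).obj F' ⟶ E)
    (h : ∀ (g : G) (V : Q.Opens) (x : Γ(F', V)),
      ρ.actSections E φ g V (e'.app (p ⁻¹ᵁ V) (unitSection p F' V x)) = e'.app (p ⁻¹ᵁ V) (unitSection p F' V x)) :
    ∃ j : F' ⟶ ρ.moduleInvariants E φ, (Scheme.Modules.pullback p).map j ≫ ρ.descentHom E φ = e' := by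
  set θ := (Scheme.Modules.pullbackPushforwardAdjunction p).homEquiv F' E e' with hθ
  have hθ0 : θ ≫ ρ.invariantsDefect E φ = 0 := by
    refine Limits.Pi.hom_ext _ _ fun g => ?_
    rw [Category.assoc, invariantsDefect, Limits.Pi.lift_π, zero_comp, Preadditive.comp_sub, Category.comp_id,
      ρ.homEquiv_comp_pushforwardAct_eq_of_actSections E φ F' e' h g, sub_self]
  refine ⟨kernel.lift (ρ.invariantsDefect E φ) θ hθ0, ?_⟩
  rw [descentHom, ← Adjunction.homEquiv_naturality_left_symm]
  change ((Scheme.Modules.pullbackPushforwardAdjunction p).homEquiv F' E).symm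
      (kernel.lift (ρ.invariantsDefect E φ) θ hθ0 ≫ kernel.ι (ρ.invariantsDefect E φ)) = e'
  rw [kernel.lift_ι, hθ, Equiv.symm_apply_apply]

/-- **A module on the quotient whose pull-back is trivial, with INVARIANT pulled-back generator, is trivial.**
For an affine flat geometric quotient `p : X ⟶ Q` by a free action of the finite group `G`, a quasi-coherent `M` on
`Q`, and `e : p^* 𝒪_Q ≅ p^* M`: if the global section `s := e(η_p 1)` of `p^* M` is fixed by the action of every
`g ∈ G` (canonical linearisation ★ `EquivariantStructure.ofPullback ρ M`), then `M ≅ 𝒪_Q`.  Indeed `e` is then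
compatible with the canonical linearisations (its value on any `η_p(y) = p^♯y · η_p(1)|` is `p^♯y · s|`, and `p^♯ y`
is `G`-fixed), so both `M` and `𝒪_Q` compare isomorphically with `(p_* p^* M)^G` (★ T1 `isIso_descentHom`, ★
`isIso_of_isIso_pullback_map`).  [MumfordAV1970] §12 Thm. 1: `Pic(X/G) → Pic(X)^G`-type descent; the kernel is
`H¹(G, Γ(X, 𝒪_X)ˣ)`, and an invariant generator is a trivial cocycle.
[cite: MumfordAV1970, §12 Thm. 1 (p. 112)] [cite: Greither1992CyclicGalois, Ch. 0 Thm. 7.1, Prop. 7.2 (pp. 28–29)] -/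
theorem nonempty_iso_unit_of_actSections_eq [IsAffineHom p] [Flat p] (hq : ρ.IsGeometricQuotient p)
    (hfree : ∀ (V : Q.Opens), IsAffineOpen V → ∀ g : G, g ≠ 1 →
      Ideal.span (Set.range fun b : Γ(X, p ⁻¹ᵁ V) ↦ ρ.act g V b - b) = ⊤)
    (M : Q.Modules) [((Scheme.Modules.pullback p).obj M).IsQuasicoherent]
    (e : (Scheme.Modules.pullback p).obj (SheafOfModules.unit Q.ringCatSheaf) ≅ (Scheme.Modules.pullback p).obj M)
    (hs : ∀ g : G, ρ.actSections _ (EquivariantStructure.ofPullback ρ M).iso g ⊤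
        (e.hom.app (p ⁻¹ᵁ ⊤) (unitSection p (SheafOfModules.unit Q.ringCatSheaf) ⊤ (1 : Γ(Q, ⊤)))) =
      e.hom.app (p ⁻¹ᵁ ⊤) (unitSection p (SheafOfModules.unit Q.ringCatSheaf) ⊤ (1 : Γ(Q, ⊤)))) :
    Nonempty (M ≅ SheafOfModules.unit Q.ringCatSheaf) := by
  have hE : IsAffineLocalizing ((Scheme.Modules.pullback p).obj M) := IsAffineLocalizing.of_isQuasicoherent _
  haveI : Surjective p := ⟨hq.surjective⟩
  haveI hdesc : IsIso (ρ.descentHom _ (EquivariantStructure.ofPullback ρ M).iso) :=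
    ρ.isIso_descentHom _ (EquivariantStructure.ofPullback ρ M).iso hq hfree hE
      (EquivariantStructure.ofPullback ρ M).iso_one_hom (EquivariantStructure.ofPullback ρ M).iso_mul_hom
  -- `M` compares with the invariants through the identity of `p^* M`
  obtain ⟨j₁, hj₁⟩ := ρ.exists_hom_moduleInvariants_fac _ (EquivariantStructure.ofPullback ρ M).iso M
    (𝟙 ((Scheme.Modules.pullback p).obj M)) fun g => by
      rw [CategoryTheory.Functor.map_id, Category.id_comp, Category.comp_id]; rfl
  -- `𝒪_Q` compares with the invariants through `e`: `e(η_p y) = p^♯ y · s|` is invariant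
  have hinv : ∀ (g : G) (V : Q.Opens) (y : Γ(SheafOfModules.unit Q.ringCatSheaf, V)),
      ρ.actSections _ (EquivariantStructure.ofPullback ρ M).iso g V (e.hom.app (p ⁻¹ᵁ V) (unitSection p _ V y)) =
        e.hom.app (p ⁻¹ᵁ V) (unitSection p _ V y) := by
    intro g V y
    rw [unitSection_unit_eq (p := p) V y, Scheme.Modules.Hom.app_smul, ρ.actSections_smul, ρ.appLE_aut_app,
      app_presheaf_map, ρ.actSections_map, hs g]
  obtain ⟨j₂, hj₂⟩ :=
    ρ.exists_hom_moduleInvariants_fac_of_actSections _ (EquivariantStructure.ofPullback ρ M).iso _ e.hom hinv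
  haveI : IsIso ((Scheme.Modules.pullback p).map j₁) := IsIso.of_isIso_fac_right hj₁
  haveI : IsIso ((Scheme.Modules.pullback p).map j₂) := IsIso.of_isIso_fac_right hj₂
  haveI : IsIso j₁ := isIso_of_isIso_pullback_map p j₁
  haveI : IsIso j₂ := isIso_of_isIso_pullback_map p j₂
  exact ⟨asIso j₁ ≪≫ (asIso j₂).symm⟩

end Trivial

/-! ## §3 Trivial modules have only invariant sections (when `G` fixes the global functions) -/

section Sections

omit [Group G] in
/-- `(p^* 𝒪_Q ⟶ 𝒪_X)(η_p(y)) = p^♯ y` — Mathlib's `SheafOfModules.pullbackObjUnitToUnit` on pulled-back sections (it is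
the adjunct of `y ↦ p^♯ y`). [cite: MumfordAV1970, §7 Prop. 2 (p. 70)] -/
theorem pullbackObjUnitToUnit_app_unitSection (p : X ⟶ Q) (V : Q.Opens) (y : Γ(SheafOfModules.unit Q.ringCatSheaf, V)) :
    Scheme.Modules.Hom.app (SheafOfModules.pullbackObjUnitToUnit p.toRingCatSheafHom) (p ⁻¹ᵁ V)
        (unitSection p (SheafOfModules.unit Q.ringCatSheaf) V y) = p.app V y := by
  have h := pullbackObj_homEquiv_app p (SheafOfModules.unit Q.ringCatSheaf)
    (N := SheafOfModules.unit X.ringCatSheaf) (SheafOfModules.pullbackObjUnitToUnit p.toRingCatSheafHom) V y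
  have h2 : (Scheme.Modules.pullbackPushforwardAdjunction p).homEquiv _ _
        (SheafOfModules.pullbackObjUnitToUnit p.toRingCatSheafHom) =
      SheafOfModules.unitToPushforwardObjUnit p.toRingCatSheafHom :=
    SheafOfModules.pullbackPushforwardAdjunction_homEquiv_pullbackObjUnitToUnit _
  have h3 := congrArg (fun ψ => (Scheme.Modules.Hom.app ψ V) y) h2
  exact h.symm.trans (h3.trans rfl)

omit [Group G] in
/-- **Every section is a multiple of a generator**: if a trivialisation `γ : E ≅ 𝒪_X` maps the section `t₁` to a
unit, then every section `t` of `E` over the same open is `b · t₁` for some function `b`.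
[cite: MumfordAV1970, §12 Thm. 1 (p. 112)] -/
theorem exists_eq_smul_of_iso_unit (E : X.Modules) (γ : E ≅ SheafOfModules.unit X.ringCatSheaf) {U : X.Opens}
    (t₁ : Γ(E, U)) (hu : IsUnit (show Γ(X, U) from γ.hom.app U t₁)) (t : Γ(E, U)) :
    ∃ b : Γ(X, U), t = b • t₁ := by
  obtain ⟨u, hu⟩ := hu
  have hinj : Function.Injective (γ.hom.app U) := by
    intro x y hxy
    have hx : γ.inv.app U (γ.hom.app U x) = x := by
      rw [← CategoryTheory.comp_apply, ← Scheme.Modules.Hom.comp_app, Iso.hom_inv_id, Scheme.Modules.Hom.id_app]; rfl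
    have hy : γ.inv.app U (γ.hom.app U y) = y := by
      rw [← CategoryTheory.comp_apply, ← Scheme.Modules.Hom.comp_app, Iso.hom_inv_id, Scheme.Modules.Hom.id_app]; rfl
    rw [← hx, ← hy, hxy]
  refine ⟨@HMul.hMul Γ(X, U) Γ(X, U) Γ(X, U) instHMul (show Γ(X, U) from γ.hom.app U t) (↑u⁻¹ : Γ(X, U)), hinj ?_⟩
  rw [Scheme.Modules.Hom.app_smul]
  change _ = @HMul.hMul Γ(X, U) Γ(X, U) Γ(X, U) instHMul
    (@HMul.hMul Γ(X, U) Γ(X, U) Γ(X, U) instHMul (show Γ(X, U) from γ.hom.app U t) (↑u⁻¹ : Γ(X, U)))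
    (show Γ(X, U) from γ.hom.app U t₁)
  rw [← hu, mul_assoc, Units.inv_mul, mul_one]

/-- **If one generator is invariant and `G` fixes the functions, every section is invariant**: let `t₁` be a section
of `E` over `p⁻¹V` fixed by the action and generating `E` there (a trivialisation `γ : E ≅ 𝒪_X` sends it to a unit),
and suppose `σ_g^♯` fixes `Γ(X, p⁻¹V)`; then `g · t = t` for every section `t` over `p⁻¹ V`.
[cite: MumfordAV1970, §12 Thm. 1 (p. 112)] -/
theorem actSections_eq_self_of_generator (E : X.Modules)
    (φ : ∀ g : G, (Scheme.Modules.pullback (ρ.aut g).hom).obj E ≅ E) (g : G) (V : Q.Opens)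
    (γ : E ≅ SheafOfModules.unit X.ringCatSheaf) (t₁ : Γ(E, p ⁻¹ᵁ V))
    (hu : IsUnit (show Γ(X, p ⁻¹ᵁ V) from γ.hom.app _ t₁)) (ht₁ : ρ.actSections E φ g V t₁ = t₁)
    (hfix : ∀ b : Γ(X, p ⁻¹ᵁ V), (ρ.aut g).hom.appLE (p ⁻¹ᵁ V) (p ⁻¹ᵁ V) (ρ.preimage_preimage g V).ge b = b)
    (t : Γ(E, p ⁻¹ᵁ V)) : ρ.actSections E φ g V t = t := by
  obtain ⟨b, rfl⟩ := exists_eq_smul_of_iso_unit E γ t₁ hu t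
  rw [ρ.actSections_smul, hfix, ht₁]

/-- **A TRIVIAL module on the quotient has only invariant pulled-back sections** (when `G` fixes the functions of
`X` over `p⁻¹V`): for `β : F ≅ 𝒪_Q`, every section of `p^* F` over `p⁻¹V` is fixed by the canonical action —
`p^* F` is generated by the invariant pulled-back section `η_p(β⁻¹(1))`. [cite: MumfordAV1970, §12 Thm. 1 (p. 112)] -/
theorem actSections_ofPullback_eq_self_of_iso_unit (F : Q.Modules) (β : F ≅ SheafOfModules.unit Q.ringCatSheaf)
    (g : G) (V : Q.Opens)
    (hfix : ∀ b : Γ(X, p ⁻¹ᵁ V), (ρ.aut g).hom.appLE (p ⁻¹ᵁ V) (p ⁻¹ᵁ V) (ρ.preimage_preimage g V).ge b = b)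
    (t : Γ((Scheme.Modules.pullback p).obj F, p ⁻¹ᵁ V)) :
    ρ.actSections _ (EquivariantStructure.ofPullback ρ F).iso g V t = t := by
  haveI : IsIso (C := X.Modules) (SheafOfModules.pullbackObjUnitToUnit p.toRingCatSheafHom) := by
    haveI := Literature.AlgebraicGeometry.KTheory.final_opensMap p
    exact SheafOfModules.instIsIsoPullbackObjUnitToUnitOfFinal _
  -- the trivialisation `p^* F ≅ p^* 𝒪_Q ≅ 𝒪_X` and the invariant generator `η_p(β⁻¹ 1)`
  let γ : (Scheme.Modules.pullback p).obj F ≅ SheafOfModules.unit X.ringCatSheaf :=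
    (Scheme.Modules.pullback p).mapIso β ≪≫ asIso (C := X.Modules) (SheafOfModules.pullbackObjUnitToUnit p.toRingCatSheafHom)
  refine ρ.actSections_eq_self_of_generator _ _ g V γ (unitSection p F V (β.inv.app V (1 : Γ(Q, V)))) ?_
    (ρ.actSections_unitSection_ofPullback F g V _) hfix t
  -- `γ(η_p(β⁻¹ 1)) = p^♯ 1 = 1`
  have hγ : (show Γ(X, p ⁻¹ᵁ V) from γ.hom.app (p ⁻¹ᵁ V) (unitSection p F V (β.inv.app V (1 : Γ(Q, V))))) = 1 := by
    change Scheme.Modules.Hom.app (SheafOfModules.pullbackObjUnitToUnit p.toRingCatSheafHom) (p ⁻¹ᵁ V)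
      (((Scheme.Modules.pullback p).map β.hom).app (p ⁻¹ᵁ V) (unitSection p F V (β.inv.app V (1 : Γ(Q, V))))) =
      (1 : Γ(X, p ⁻¹ᵁ V))
    rw [pullback_map_app_unitSection, ← CategoryTheory.comp_apply, ← Scheme.Modules.Hom.comp_app, β.inv_hom_id,
      Scheme.Modules.Hom.id_app, CategoryTheory.id_apply, pullbackObjUnitToUnit_app_unitSection]
    exact map_one (p.app V).hom
  rw [hγ]
  exact isUnit_one

end Sections

end Main

/-! ## §4 Restriction of the action along an equivariant square -/

section Restrict

variable {X S Q Q' : Scheme.{u}} {q : X ⟶ Q} {q' : S ⟶ Q'} {G : Type u} [Group G]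
  (ρ : ActionOver q G) (τ : ActionOver q' G) (ι : S ⟶ X) (κ : Q' ⟶ Q) (hsq : ι ≫ q = q' ≫ κ)
  (hι : ∀ g : G, τ.autHom g ≫ ι = ι ≫ ρ.autHom g)

include hι in
/-- **The action on a restricted global section along an equivariant square.** For a commuting square `ι ≫ q = q′ ≫ κ`
compatible with the actions `ρ` (on `X/Q`) and `τ` (on `S/Q′`), a finite locally free `F` on `Q`, and a global section `s`
of `q^* F` on which `g` acts by the function `a` (`g · s = a s`), the restricted section
`s′ := squareIso(η_ι(s))` of `q′^* κ^* F` satisfies `g · s′ = ι^♯(a) s′` (★ `restrictAlong_ofPullback`: the canonical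
linearisation restricts to the canonical linearisation). [cite: MumfordAV1970, §7 Prop. 2 (p. 70)]
[cite: MumfordFogartyKirwan1994, Ch. 1 §3 Definition 1.6 (p. 30)] -/
theorem actSections_squareIso_unitSection {F : Q.Modules} (hF : IsFiniteLocallyFree F) (g : G)
    (s : Γ((Scheme.Modules.pullback q).obj F, q ⁻¹ᵁ ⊤)) (a : Γ(X, q ⁻¹ᵁ ⊤))
    (hs : ρ.actSections _ (EquivariantStructure.ofPullback ρ F).iso g ⊤ s = a • s) :
    τ.actSections _ (EquivariantStructure.ofPullback τ ((Scheme.Modules.pullback κ).obj F)).iso g ⊤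
        ((squareIso hsq F).hom.app (q' ⁻¹ᵁ ⊤)
          (unitSection ι ((Scheme.Modules.pullback q).obj F) (q ⁻¹ᵁ ⊤) s)) =
      ι.appLE (q ⁻¹ᵁ ⊤) (q' ⁻¹ᵁ ⊤) (le_of_eq rfl) a •
        (squareIso hsq F).hom.app (q' ⁻¹ᵁ ⊤)
          (unitSection ι ((Scheme.Modules.pullback q).obj F) (q ⁻¹ᵁ ⊤) s) := by
  -- the intertwining relation ★ `restrictAlong_ofPullback`, evaluated at `η_{τ_g}(η_ι(s))`
  have key := congrArg (fun ψ => Scheme.Modules.Hom.app ψ ((τ.aut g).hom ⁻¹ᵁ (q' ⁻¹ᵁ ⊤))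
      (unitSection (τ.aut g).hom ((Scheme.Modules.pullback ι).obj ((Scheme.Modules.pullback q).obj F)) (q' ⁻¹ᵁ ⊤)
        (unitSection ι ((Scheme.Modules.pullback q).obj F) (q ⁻¹ᵁ ⊤) s)))
    (restrictAlong_ofPullback ρ τ ι κ hsq hι hF g)
  simp only [Scheme.Modules.Hom.comp_app, CategoryTheory.comp_apply] at key
  rw [pullback_map_app_unitSection] at key
  -- the left-hand side of `key`: ★ `restrictAlong_app_unitSection` (spelled on the opens `q'⁻¹⊤`)
  have hL : (restrictAlong ρ τ ι hι ((Scheme.Modules.pullback q).obj F) g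
        ((EquivariantStructure.ofPullback ρ F).iso g).hom).app ((τ.aut g).hom ⁻¹ᵁ (q' ⁻¹ᵁ ⊤))
        (unitSection (τ.aut g).hom ((Scheme.Modules.pullback ι).obj ((Scheme.Modules.pullback q).obj F)) (q' ⁻¹ᵁ ⊤)
          (unitSection ι ((Scheme.Modules.pullback q).obj F) (q ⁻¹ᵁ ⊤) s)) = _ :=
    restrictAlong_app_unitSection ρ τ ι hι ((Scheme.Modules.pullback q).obj F) g
      ((EquivariantStructure.ofPullback ρ F).iso g).hom (q ⁻¹ᵁ ⊤) s
  rw [hL] at key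
  -- unpack `hs`: `(φ g)(η_{σ_g} s) = a • s` transported
  have hφ : ((EquivariantStructure.ofPullback ρ F).iso g).hom.app (ρ.autHom g ⁻¹ᵁ (q ⁻¹ᵁ ⊤))
        (unitSection (ρ.autHom g) ((Scheme.Modules.pullback q).obj F) (q ⁻¹ᵁ ⊤) s) =
      ((Scheme.Modules.pullback q).obj F).presheaf.map (eqToHom (ρ.preimage_preimage g ⊤)).op (a • s) := by
    rw [← hs, ρ.actSections_eq]
    exact ((presheaf_map_map_congr _ _ _ (𝟙 _) _).trans (presheaf_map_self _ _ _)).symm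
  rw [hφ, Scheme.Modules.map_smul, unitSection_smul, unitSection_map, Scheme.Modules.map_smul,
    Scheme.Modules.Hom.app_smul] at key
  -- the action on `s′`, by ★ `actSections_eq`, is the right-hand side of `key`
  rw [τ.actSections_eq, ← key, Scheme.Modules.map_smul]
  congr 1
  · -- the scalar: `ι^♯ a` restricted along (iso)morphisms between opens all equal to `⊤`
    rw [Scheme.Hom.app_eq_appLE]
    simp only [← CommRingCat.comp_apply, Scheme.Hom.map_appLE, Scheme.Hom.appLE_map]
    have hsc : ∀ {V V' : S.Opens} (e : V ≤ ι ⁻¹ᵁ (q ⁻¹ᵁ ⊤)) (i : V' ⟶ V) (y : Γ(X, q ⁻¹ᵁ ⊤)),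
        S.presheaf.map i.op (ι.appLE (q ⁻¹ᵁ ⊤) V e y) = ι.appLE (q ⁻¹ᵁ ⊤) V' (i.le.trans e) y := by
      intro V V' e i y
      rw [← CategoryTheory.comp_apply, Scheme.Hom.appLE_map]
    exact hsc _ (eqToHom _) a
  · -- the section: transports of `s′ = squareIso(η_ι s)` along endomorphisms of `⊤`
    rw [← Scheme.Modules.Hom.app_map_apply]
    congr 1
    exact (presheaf_map_map_congr _ _ _ (eqToHom rfl) _).trans
      ((presheaf_map_map_congr _ _ _ (eqToHom rfl) _).trans (presheaf_map_self _ _ _))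

end Restrict

end Literature.AlgebraicGeometry.RelativeSpec.ActionOver

end
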